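import Summits.ResolutionOfSingularities.ResolutionOfSingularities.Theorems.EquisingularLiftEquisingularLiftLinearCentreLift
import Summits.ResolutionOfSingularities.ResolutionOfSingularities.Theorems.EquisingularLiftEquisingularLiftLinearCentreOfBlowupModel
import Summits.ResolutionOfSingularities.ResolutionOfSingularities.Theorems.EquisingularLiftEquisingularLiftBlowupModelThree
import Summits.ResolutionOfSingularities.ResolutionOfSingularities.Theorems.EquisingularLiftEquisingularLiftBlowupModelFour
import Summits.ResolutionOfSingularities.ResolutionOfSingularities.Theorems.EquisingularLiftEquisingularLiftCurveCase
import HarnessLib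

/-!
# `EquisingularLift` (stmt-ResolutionOfSingularities-15660), line `Sketch` v10b — BANKED LOW-DIMENSIONAL CASES `n ≤ 3`, `n ≤ 4`

[OURS · L1 W4.5(b)] Not a statement of any manuscript; AI-assembled, weaker than expert review. CHAIN w45b v3 §2:
«EL(3) and EL(4) BANKED as OURS theorems CLOSED-MODULO-FACTS»; reporting sentence of record «typed door alive-by-theorem
n ≤ 4, summit-equivalent n ≥ 5».

The `∃`-block of the crux `Theses.EquisingularLift.EquisingularLift` (char-`0` DVR `O`, smooth proper `P/O`, `Y ⊆ P_s` with
`V(Y)_red ≅ H`, blow-ups in regular centres off the generic point of `Y`, irreducible special fibre, regular reduced strict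
transform) for every integral hypersurface `H ⊆ ℙⁿ_k` with locally principal ideal, `k` algebraically closed of
characteristic `p`, RESTRICTED IN THE DIMENSION and closed modulo published resolution theorems only:

* `EL_of_blowupModel_all` — `BM(H) ⇒ EL(H)` for every `n` (UNCONDITIONAL): the registered stubs `stub_linearCentre_of_blowupModel`
  (p482152, re-embedding) and `stub_linearCentre_lift` (p479070, the linear-centre lift) composed;
* `equisingularLift_le_three_of_CJS` — `n ≤ 3`, CONDITIONAL ONLY on the named fact `CossartJannsenSaito2020Sequence`
  (Cossart–Jannsen–Saito 2020 Intro. Thm. 1 / Lipman 1978: resolution of excellent surfaces by a finite sequence of blow-ups);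
* `equisingularLift_le_four_of_CJS_CP` — `n ≤ 4`, conditional in addition on `CossartPiltant2019General` (CP 2019 Thm. 1.1)
  and `CossartPiltant2019Principalization` (CP 2019 Prop. 4.4). No `n ≥ 5` residual enters these two theorems.

The full crux modulo the same facts AND the declared residual `stub_blowupModel_ge_five` is the lead's
`…Theorems.EquisingularLiftEquisingularLiftOfBlowupModels` (not restated here). Ingredients (all in the tree):
`equisingularLift_of_le_two` (p171618; `n ≤ 2`), `stub_blowupModel_three_of_CJS` (p477552), `stub_blowupModel_four_of_CP`
(p479009).
-/

set_option linter.dupNamespace false -- mandated namespace `Summit.<Summit>.<Problem>` of this single-conjunct summit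
set_option linter.overlappingInstances false -- registered signatures carry `[IsDomain O] [IsDiscreteValuationRing O]`

noncomputable section

open CategoryTheory AlgebraicGeometry
open Literature.AlgebraicGeometry.Resolution

namespace Summit.ResolutionOfSingularities.ResolutionOfSingularities.Cruxes.EquisingularLift.StrataSplit

/-! ## Regular blow-up models give the `∃`-block, for every `n` -/

/-- **`BM(H) ⇒ EL(H)` for every `n` (unconditional).** A regular projective blow-up model of the integral
hypersurface `H ⊆ ℙⁿ_k` (`𝔞 ≠ 0` all of whose blow-ups are regular) gives the `∃`-block of `EquisingularLift` for `H`: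
re-embed `H` so that the model is the strict transform under the blow-up of a coordinate linear subspace
(`stub_linearCentre_of_blowupModel`, p482152) and lift that linear centre to `𝕎(k)` (`stub_linearCentre_lift`, p479070).
[OURS · L1 W4.5b] -/
theorem EL_of_blowupModel_all :
    ∀ p : ℕ, p.Prime → ∀ (k : Type) [Field k] [CharP k p] [IsAlgClosed k] (n : ℕ) (H : AlgebraicGeometry.Scheme.{0}) (ι : H ⟶ (Literature.AlgebraicGeometry.Motives.projectiveSpace n k).left), AlgebraicGeometry.IsClosedImmersion ι → AlgebraicGeometry.IsIntegral H → (∀ y : (Literature.AlgebraicGeometry.Motives.projectiveSpace n k).left, ∃ U : (Literature.AlgebraicGeometry.Motives.projectiveSpace n k).left.affineOpens, y ∈ (U : (Literature.AlgebraicGeometry.Motives.projectiveSpace n k).left.Opens) ∧ (ι.ker.ideal U).IsPrincipal) → (∃ 𝔞 : H.IdealSheafData, 𝔞 ≠ ⊥ ∧ ∀ (Z : AlgebraicGeometry.Scheme.{0}) (π : Z ⟶ H), Literature.AlgebraicGeometry.Resolution.IsBlowup π 𝔞 → Literature.AlgebraicGeometry.Resolution.Scheme.IsRegular Z) → ∃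 (O : Type) (_ : CommRing O) (_ : IsDomain O) (_ : IsDiscreteValuationRing O) (_ : CharZero O) (P P' : AlgebraicGeometry.Scheme.{0}) (q : P ⟶ AlgebraicGeometry.Spec (.of O)) (Y : TopologicalSpace.Closeds P) (σ : P' ⟶ P) (S' : Set P'), AlgebraicGeometry.Smooth q ∧ AlgebraicGeometry.IsProper q ∧ (Y : Set P) ⊆ q ⁻¹' {IsLocalRing.closedPoint O} ∧ Nonempty ((AlgebraicGeometry.Scheme.IdealSheafData.vanishingIdeal Y).subscheme ≅ H) ∧ (∀ Q : (∀ X' : AlgebraicGeometry.Scheme.{0}, (X' ⟶ P) → Set X' → Prop), Q P (CategoryTheory.CategoryStruct.id P) (Y : Set P) → (∀ (X' X'' : AlgebraicGeometry.Scheme.{0}) (σ' : X' ⟶ P) (Y' : Set X') (C : X'.IdealSheafData) (τ : X'' ⟶ X'), Q X' σ' Y' → Literature.AlgebraicGeometry.Resolution.IsBlowup τ C → Literature.AlgebraicGeometry.Resolution.Scheme.IsRegular C.subscheme → σ' '' (C.support : Set X') ⊆ {x : P | ¬ IsGenericPoint x (Y : Set P)} → Q X'' (CategoryTheory.CategoryStruct.comp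 τ σ') (closure (τ ⁻¹' (Y' \ (C.support : Set X'))))) → Q P' σ S') ∧ IsIrreducible ((CategoryTheory.CategoryStruct.comp σ q) ⁻¹' {IsLocalRing.closedPoint O}) ∧ Literature.AlgebraicGeometry.Resolution.Scheme.IsRegular (AlgebraicGeometry.Scheme.IdealSheafData.vanishingIdeal (⟨closure S', isClosed_closure⟩ : TopologicalSpace.Closeds P')).subscheme := by
  intro p hp k _ _ _ n H ι hι hH hloc hBM
  obtain ⟨r, m, fk, hfk', j, hfkC, hfkX, hj, hnot, hres⟩ :=
    stub_linearCentre_of_blowupModel p hp k n H ι hι hH hloc hBM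
  exact stub_linearCentre_lift p hp k H hH r m fk hfk' hfkC hfkX j hj hnot hres

/-! ## `n ≤ 3`: modulo Cossart–Jannsen–Saito only -/

/-- **EL for `n ≤ 3` (points, `ℙ¹`, `ℙ²`, plane curves, `ℙ³`, surfaces in `ℙ³`), closed modulo
`CossartJannsenSaito2020Sequence` alone**: `n ≤ 2` is `equisingularLift_of_le_two` (p171618); `n = 3` is the linear-centre
lift of the regular blow-up model supplied by `stub_blowupModel_three_of_CJS` (p477552). [OURS · L1 W4.5b]
[cite: CossartJannsenSaito2020, Thm. 1 (Introduction)] -/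
theorem equisingularLift_le_three_of_CJS (hCJS : CossartJannsenSaito2020Sequence.{0}) :
    ∀ p : ℕ, p.Prime → ∀ (k : Type) [Field k] [CharP k p] [IsAlgClosed k] (n : ℕ) (H : AlgebraicGeometry.Scheme.{0}) (ι : H ⟶ (Literature.AlgebraicGeometry.Motives.projectiveSpace n k).left), AlgebraicGeometry.IsClosedImmersion ι → AlgebraicGeometry.IsIntegral H → (∀ y : (Literature.AlgebraicGeometry.Motives.projectiveSpace n k).left, ∃ U : (Literature.AlgebraicGeometry.Motives.projectiveSpace n k).left.affineOpens, y ∈ (U : (Literature.AlgebraicGeometry.Motives.projectiveSpace n k).left.Opens) ∧ (ι.ker.ideal U).IsPrincipal) → n ≤ 3 → ∃ (O : Type) (_ : CommRing O) (_ : IsDomain O) (_ : IsDiscreteValuationRing O) (_ : CharZero O) (P P' : AlgebraicGeometry.Scheme.{0}) (q : P ⟶ AlgebraicGeometry.Spec (.of O)) (Y : TopologicalSpace.Closeds P) (σ : P' ⟶ P) (S' : Set P'), AlgebraicGeometry.Smooth q ∧ AlgebraicGeometry.IsProper q ∧ (Y : Set P) ⊆ q ⁻¹' {IsLocalRing.closedPoint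 O} ∧ Nonempty ((AlgebraicGeometry.Scheme.IdealSheafData.vanishingIdeal Y).subscheme ≅ H) ∧ (∀ Q : (∀ X' : AlgebraicGeometry.Scheme.{0}, (X' ⟶ P) → Set X' → Prop), Q P (CategoryTheory.CategoryStruct.id P) (Y : Set P) → (∀ (X' X'' : AlgebraicGeometry.Scheme.{0}) (σ' : X' ⟶ P) (Y' : Set X') (C : X'.IdealSheafData) (τ : X'' ⟶ X'), Q X' σ' Y' → Literature.AlgebraicGeometry.Resolution.IsBlowup τ C → Literature.AlgebraicGeometry.Resolution.Scheme.IsRegular C.subscheme → σ' '' (C.support : Set X') ⊆ {x : P | ¬ IsGenericPoint x (Y : Set P)} → Q X'' (CategoryTheory.CategoryStruct.comp τ σ') (closure (τ ⁻¹' (Y' \ (C.support : Set X'))))) → Q P' σ S') ∧ IsIrreducible ((CategoryTheory.CategoryStruct.comp σ q) ⁻¹' {IsLocalRing.closedPoint O}) ∧ Literature.AlgebraicGeometry.Resolution.Scheme.IsRegular (AlgebraicGeometry.Scheme.IdealSheafData.vanishingIdeal (⟨closure S', isClosed_closure⟩ : TopologicalSpace.Closeds P')).subscheme := by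
  intro p hp k _ _ _ n H ι hι hH hloc hn
  by_cases h2 : n ≤ 2
  · exact equisingularLift_of_le_two p hp k n H ι hι hH hloc h2
  · have h3 : n = 3 := by omega
    exact EL_of_blowupModel_all p hp k n H ι hι hH hloc
      (stub_blowupModel_three_of_CJS hCJS p hp k n H ι hι hH hloc h3)

/-! ## `n ≤ 4`: modulo Cossart–Jannsen–Saito and Cossart–Piltant -/

/-- **EL for `n ≤ 4` (… and threefolds in `ℙ⁴`), closed modulo `CossartJannsenSaito2020Sequence`,
`CossartPiltant2019General` and `CossartPiltant2019Principalization`** — the kernel form of «typed door alive-by-theorem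
n ≤ 4»: `n = 4` is the linear-centre lift of the regular blow-up model supplied by `stub_blowupModel_four_of_CP` (p479009).
[OURS · L1 W4.5b] [cite: CossartPiltant2019, Thm. 1.1 and Prop. 4.4] -/
theorem equisingularLift_le_four_of_CJS_CP (hCJS : CossartJannsenSaito2020Sequence.{0})
    (hCP : CossartPiltant2019General.{0}) (hPr : CossartPiltant2019Principalization.{0}) :
    ∀ p : ℕ, p.Prime → ∀ (k : Type) [Field k] [CharP k p] [IsAlgClosed k] (n : ℕ) (H : AlgebraicGeometry.Scheme.{0}) (ι : H ⟶ (Literature.AlgebraicGeometry.Motives.projectiveSpace n k).left), AlgebraicGeometry.IsClosedImmersion ι → AlgebraicGeometry.IsIntegral H → (∀ y : (Literature.AlgebraicGeometry.Motives.projectiveSpace n k).left, ∃ U : (Literature.AlgebraicGeometry.Motives.projectiveSpace n k).left.affineOpens, y ∈ (U : (Literature.AlgebraicGeometry.Motives.projectiveSpace n k).left.Opens) ∧ (ι.ker.ideal U).IsPrincipal) → n ≤ 4 → ∃ (O : Type) (_ : CommRing O) (_ : IsDomain O) (_ : IsDiscreteValuationRing O) (_ : CharZero O) (P P' : AlgebraicGeometry.Scheme.{0})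 (q : P ⟶ AlgebraicGeometry.Spec (.of O)) (Y : TopologicalSpace.Closeds P) (σ : P' ⟶ P) (S' : Set P'), AlgebraicGeometry.Smooth q ∧ AlgebraicGeometry.IsProper q ∧ (Y : Set P) ⊆ q ⁻¹' {IsLocalRing.closedPoint O} ∧ Nonempty ((AlgebraicGeometry.Scheme.IdealSheafData.vanishingIdeal Y).subscheme ≅ H) ∧ (∀ Q : (∀ X' : AlgebraicGeometry.Scheme.{0}, (X' ⟶ P) → Set X' → Prop), Q P (CategoryTheory.CategoryStruct.id P) (Y : Set P) → (∀ (X' X'' : AlgebraicGeometry.Scheme.{0}) (σ' : X' ⟶ P) (Y' : Set X') (C : X'.IdealSheafData) (τ : X'' ⟶ X'), Q X' σ' Y' → Literature.AlgebraicGeometry.Resolution.IsBlowup τ C → Literature.AlgebraicGeometry.Resolution.Scheme.IsRegular C.subscheme → σ' '' (C.support : Set X') ⊆ {x : P | ¬ IsGenericPoint x (Y : Set P)} → Q X'' (CategoryTheory.CategoryStruct.comp τ σ') (closure (τ ⁻¹' (Y' \ (C.support : Set X'))))) → Q P' σ S') ∧ IsIrreducible ((CategoryTheory.CategoryStruct.comp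 σ q) ⁻¹' {IsLocalRing.closedPoint O}) ∧ Literature.AlgebraicGeometry.Resolution.Scheme.IsRegular (AlgebraicGeometry.Scheme.IdealSheafData.vanishingIdeal (⟨closure S', isClosed_closure⟩ : TopologicalSpace.Closeds P')).subscheme := by
  intro p hp k _ _ _ n H ι hι hH hloc hn
  by_cases h3 : n ≤ 3
  · exact equisingularLift_le_three_of_CJS hCJS p hp k n H ι hι hH hloc h3
  · have h4 : n = 4 := by omega
    exact EL_of_blowupModel_all p hp k n H ι hι hH hloc
      (stub_blowupModel_four_of_CP hCP hPr p hp k n H ι hι hH hloc h4)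

end Summit.ResolutionOfSingularities.ResolutionOfSingularities.Cruxes.EquisingularLift.StrataSplit

end
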